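import Summits.QuantumFields.YangMills.Theorems.Z2SelfDualityTorusPrimitives
import Summits.QuantumFields.YangMills.Theorems.Z2SelfDualityDualMap
import HarnessLib

/-!
# `ℤ₂` lattice gauge theory on the torus: counting flat configurations, closed versus exact sums

Support file for `…Theses.ModularSelfDualFold.Z2TorusFreeEnergySelfDuality`. The two
"cohomological" estimates of the Kramers–Wannier argument on the torus `(ℤ/Mℤ)^d`, both with an
error exponential in the size of the *seam* only (`O(M^{d-1})` cells, negligible against `M^d`):

* `two_mul_flatCount_ge`, `flatCount_le`: the number `K` of flat `ℤ₂` configurations satisfies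
  `2^{#sites} ≤ 2 K` (pure gauges, whose only redundancy is the global constant) and
  `K ≤ 2^{#sites + #seamEdge}` (a flat configuration is a pure gauge off the seam,
  `exists_potential_off_seam`).
* `exactSum_le_closedSum`, `closedSum_le` (`d = 4`): with `A(t) = ∑_{η closed} t^{#supp η}` and
  `B(t) = ∑_{η exact} t^{#supp η}`, `B ≤ A ≤ (2/t)^{#seamPlaq} · B` for `0 < t ≤ 1` (exact ⊆ closed;
  a closed function is exact off the seam, `exists_td₁_eq_off_seam`).

Everything here is proved.
-/

noncomputable section

namespace Summit.QuantumFields.YangMills.Theorems.Z2SelfDuality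

open Finset
open Literature.MathematicalPhysics.QuantumFieldTheory
open Literature.MathematicalPhysics.QuantumFieldTheory.LatticeForm

variable {d M : ℕ}

/-! ### Translation-invariant functions on the torus are constant -/

/-- A function on the discrete torus invariant under all unit translations is constant. [folklore] -/
theorem eq_apply_zero_of_invariant [NeZero M] {α : Type*} (h : Site d M → α)
    (hh : ∀ (x : Site d M) (i : Fin d), h (x + te i) = h x) (x : Site d M) : h x = h 0 := by
  classical
  -- invariance under multiples of the unit translations
  have hn : ∀ (y : Site d M) (i : Fin d) (n : ℕ), h (y + n • (te i : Site d M)) = h y := by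
    intro y i n
    induction n with
    | zero => simp
    | succ n ih => rw [succ_nsmul, ← add_assoc, hh, ih]
  -- peel off the coordinates one at a time
  have hsum : ∀ (s : Finset (Fin d)) (y : Site d M),
      h (y + ∑ i ∈ s, (x i).val • (te i : Site d M)) = h y := by
    intro s
    induction s using Finset.induction_on with
    | empty => intro y; simp
    | insert a s ha ih =>
      intro y
      rw [Finset.sum_insert ha, ← add_assoc, add_right_comm, hn, ih]
  have hx : x = 0 + ∑ i : Fin d, (x i).val • (te i : Site d M) := by
    funext m
    rw [zero_add, Finset.sum_apply, Finset.sum_eq_single m]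
    · simp [te]
    · intro i _ him; simp [te, Pi.single_eq_of_ne (Ne.symm him)]
    · intro hm; exact absurd (Finset.mem_univ m) hm
  rw [hx, hsum]

/-! ### Counting flat configurations -/

/-- The pure gauge `U(x, i) = g(x) g(x + eᵢ)⁻¹` of a `ℤ₂`-valued function on the sites. [folklore] -/
def pureGauge (g : Site d M → Z2) : GaugeConfig d M Z2 := fun e => g e.1 * (g (e.1 + te e.2))⁻¹

/-- Pure gauges are flat. [folklore] -/
theorem plaqField_pureGauge (g : Site d M → Z2) : plaqField (pureGauge g) = 0 := by
  funext p
  obtain ⟨x, ⟨i, j⟩, hij⟩ := p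
  rw [plaqField_apply, Pi.zero_apply]
  simp only [plaquetteHolonomy, pureGauge, Site.shift, te, ofMul_mul, ofMul_inv]
  rw [add_right_comm x (Pi.single j (1 : ZMod M)) (Pi.single i (1 : ZMod M))]
  abel

/-- Two functions with the same pure gauge differ by a global constant. [folklore] -/
theorem pureGauge_eq_iff_const [NeZero M] {g g' : Site d M → Z2} (h : pureGauge g = pureGauge g') :
    ∃ c : Z2, g' = fun x => g x * c := by
  have hinv : ∀ (x : Site d M) (i : Fin d), (g x)⁻¹ * g' x = (g (x + te i))⁻¹ * g' (x + te i) := by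
    intro x i
    have := congrFun h (x, i)
    simp only [pureGauge] at this
    -- `g x * (g (x+eᵢ))⁻¹ = g' x * (g' (x+eᵢ))⁻¹` in an abelian group
    calc (g x)⁻¹ * g' x = (g x)⁻¹ * g' x * ((g' (x + te i))⁻¹ * g' (x + te i)) := by group
      _ = (g x)⁻¹ * (g' x * (g' (x + te i))⁻¹) * g' (x + te i) := by group
      _ = (g x)⁻¹ * (g x * (g (x + te i))⁻¹) * g' (x + te i) := by rw [← this]
      _ = (g (x + te i))⁻¹ * g' (x + te i) := by group
  refine ⟨(g 0)⁻¹ * g' 0, funext fun x => ?_⟩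
  have hc := eq_apply_zero_of_invariant (fun x => (g x)⁻¹ * g' x) (fun x i => (hinv x i).symm) x
  rw [← hc, mul_inv_cancel_left]

/-- **Lower bound on flat configurations**: `2^{#sites} ≤ 2 · K` (every pure gauge is flat, and
`g ↦ pureGauge g` is at most two-to-one). [folklore] -/
theorem two_mul_flatCount_ge [NeZero M] : 2 ^ Fintype.card (Site d M) ≤ 2 * flatCount d M := by
  classical
  have himg : (Finset.univ.image (pureGauge (d := d) (M := M))).card ≤ flatCount d M := by
    unfold flatCount
    refine Finset.card_le_card fun U hU => ?_
    obtain ⟨g, -, rfl⟩ := Finset.mem_image.1 hU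
    exact Finset.mem_filter.2 ⟨Finset.mem_univ _, plaqField_pureGauge g⟩
  have hfib : ∀ b ∈ Finset.univ.image (pureGauge (d := d) (M := M)),
      (Finset.univ.filter fun g : Site d M → Z2 => pureGauge g = b).card ≤ 2 := by
    intro b hb
    obtain ⟨g₀, -, rfl⟩ := Finset.mem_image.1 hb
    calc (Finset.univ.filter fun g : Site d M → Z2 => pureGauge g = pureGauge g₀).card
        ≤ (Finset.univ.image fun c : Z2 => fun x => g₀ x * c).card := by
          refine Finset.card_le_card fun g hg => ?_
          obtain ⟨c, hc⟩ := pureGauge_eq_iff_const ((Finset.mem_filter.1 hg).2).symm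
          exact Finset.mem_image.2 ⟨c, Finset.mem_univ _, hc.symm⟩
      _ ≤ (Finset.univ : Finset Z2).card := Finset.card_image_le
      _ = 2 := by simp
  have h := Finset.card_le_mul_card_image (Finset.univ : Finset (Site d M → Z2)) 2 hfib
  rw [Finset.card_univ, Fintype.card_fun] at h
  have h2 : Fintype.card Z2 = 2 := by simp
  rw [h2] at h
  exact h.trans (Nat.mul_le_mul_left 2 himg)

/-- The link field of a flat configuration is flat on all index pairs. [folklore] -/
theorem td₁_linkField_eq_zero_of_flat {U : GaugeConfig d M Z2} (hU : plaqField U = 0)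
    (y : Site d M) (i j : Fin d) : td₁ (linkField U) y i j = 0 := by
  rcases lt_trichotomy i j with hij | rfl | hij
  · have := congrFun hU (y, ⟨(i, j), hij⟩)
    simpa [plaqField, res] using this
  · exact td₁_self _ y i
  · have := congrFun hU (y, ⟨(j, i), hij⟩)
    rw [td₁_swap]
    simpa [plaqField, res] using this

/-- **Upper bound on flat configurations**: `K ≤ 2^{#sites + #seamEdge}` — a flat configuration is
determined by a potential (`exists_potential_off_seam`) and its values on the seam edges. [folklore] -/
theorem flatCount_le [NeZero M] :
    flatCount d M ≤ 2 ^ (Fintype.card (Site d M) + (seamEdge d M).card) := by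
  classical
  -- choose a potential for every flat configuration
  have hpot : ∀ U : GaugeConfig d M Z2, plaqField U = 0 →
      ∃ g : Site d M → A2, ∀ (y : Site d M) (i : Fin d), (y i).val ≠ M - 1 →
        g (y + te i) - g y = linkField U y i :=
    fun U hU => exists_potential_off_seam (td₁_linkField_eq_zero_of_flat hU)
  choose! pot hpot using hpot
  set F : GaugeConfig d M Z2 → (Site d M → A2) × (seamEdge d M → Z2) :=
    fun U => (pot U, fun e => U e.1) with hF
  have hinj : Set.InjOn F ↑(Finset.univ.filter fun U : GaugeConfig d M Z2 => plaqField U = 0) := by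
    intro U hU V hV hUV
    simp only [Finset.coe_filter, Finset.mem_univ, true_and, Set.mem_setOf_eq] at hU hV
    simp only [hF, Prod.mk.injEq] at hUV
    obtain ⟨h1, h2⟩ := hUV
    funext ⟨y, i⟩
    by_cases hs : (y i).val = M - 1
    · have := congrFun h2 ⟨(y, i), mem_seamEdge.2 hs⟩
      exact this
    · have hUe := hpot U hU y i hs
      have hVe := hpot V hV y i hs
      rw [h1] at hUe
      have : linkField U y i = linkField V y i := hUe.symm.trans hVe
      exact Additive.ofMul.injective this
  calc flatCount d M
      = (Finset.univ.filter fun U : GaugeConfig d M Z2 => plaqField U = 0).card := rfl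
    _ ≤ (Finset.univ : Finset ((Site d M → A2) × (seamEdge d M → Z2))).card :=
        Finset.card_le_card_of_injOn F (fun U _ => Finset.mem_univ _) hinj
    _ = 2 ^ (Fintype.card (Site d M) + (seamEdge d M).card) := by
        simp [Fintype.card_prod, pow_add]

/-! ### Closed versus exact sums (`d = 4`) -/

/-- Exact plaquette fields are closed, so `B(t) ≤ A(t)` for `t ≥ 0`. [folklore] -/
theorem exactSum_le_closedSum [NeZero M] {t : ℝ} (ht : 0 ≤ t) : exactSum 4 M t ≤ closedSum M t := by
  classical
  unfold exactSum closedSum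
  refine Finset.sum_le_sum_of_subset_of_nonneg (fun η hη => ?_) (fun η _ _ => pow_nonneg ht _)
  obtain ⟨U, -, rfl⟩ := Finset.mem_image.1 hη
  exact Finset.mem_filter.2 ⟨Finset.mem_univ _, isClosedPl_plaqField U⟩

/-- Killing the values on the seam plaquettes. [folklore] -/
def offSeam [NeZero M] (η : Plaquette 4 M → A2) : Plaquette 4 M → A2 :=
  fun p => if p ∈ seamPlaq 4 M then 0 else η p

/-- The support off the seam is contained in the support. [folklore] -/
theorem card_support_offSeam_le [NeZero M] (η : Plaquette 4 M → A2) :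
    (Finset.univ.filter fun p => offSeam η p ≠ 0).card ≤ (Finset.univ.filter fun p => η p ≠ 0).card := by
  classical
  refine Finset.card_le_card fun p hp => ?_
  simp only [Finset.mem_filter, Finset.mem_univ, true_and, offSeam] at hp ⊢
  by_cases h : p ∈ seamPlaq 4 M
  · simp [h] at hp
  · simpa [h] using hp

/-- The support exceeds the support off the seam by at most the seam. [folklore] -/
theorem card_support_le_offSeam_add [NeZero M] (η : Plaquette 4 M → A2) :
    (Finset.univ.filter fun p => η p ≠ 0).card ≤
      (Finset.univ.filter fun p => offSeam η p ≠ 0).card + (seamPlaq 4 M).card := by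
  classical
  calc (Finset.univ.filter fun p => η p ≠ 0).card
      ≤ ((Finset.univ.filter fun p => offSeam η p ≠ 0) ∪ seamPlaq 4 M).card := by
        refine Finset.card_le_card fun p hp => ?_
        simp only [Finset.mem_filter, Finset.mem_univ, true_and] at hp
        rw [Finset.mem_union, Finset.mem_filter]
        by_cases h : p ∈ seamPlaq 4 M
        · exact Or.inr h
        · exact Or.inl ⟨Finset.mem_univ _, by simpa [offSeam, h] using hp⟩
    _ ≤ _ := Finset.card_union_le _ _

/-- A closed plaquette function agrees off the seam with an exact one. [folklore] -/
theorem exists_exact_offSeam_eq [NeZero M] {η : Plaquette 4 M → A2} (hη : IsClosedPl η) :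
    ∃ b ∈ Finset.univ.image (plaqField (d := 4) (L := M) (G := Z2)), offSeam b = offSeam η := by
  classical
  obtain ⟨θ, hθ⟩ := exists_td₁_eq_off_seam hη
  refine ⟨plaqField (fun e => Additive.toMul (θ e.1 e.2)), Finset.mem_image.2 ⟨_, Finset.mem_univ _, rfl⟩, ?_⟩
  have hlink : linkField (fun e : Edge 4 M => Additive.toMul (θ e.1 e.2)) = θ := by
    funext x i; simp [linkField]
  funext p
  simp only [offSeam]
  split_ifs with hp
  · rfl
  · rw [plaqField, hlink]
    exact hθ p hp

/-- **Closed versus exact** (`d = 4`): for `0 < t ≤ 1`,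
`A(t) ≤ (2/t)^{#seamPlaq} · B(t)` — every closed function is exact off the seam, it is determined
by its off-seam part and its `#seamPlaq` seam values, and discarding the seam changes the weight
`t^{#supp}` by at most a factor `t^{-#seamPlaq}`. [folklore] -/
theorem closedSum_le [NeZero M] {t : ℝ} (ht : 0 < t) (ht1 : t ≤ 1) :
    closedSum M t ≤ (2 / t) ^ (seamPlaq 4 M).card * exactSum 4 M t := by
  classical
  set s := (seamPlaq 4 M).card with hs
  set C := (Finset.univ : Finset (Plaquette 4 M → A2)).filter (fun η => IsClosedPl η) with hC
  set E := Finset.univ.image (plaqField (d := 4) (L := M) (G := Z2)) with hE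
  set w : (Plaquette 4 M → A2) → ℝ := fun η => t ^ (Finset.univ.filter fun p => η p ≠ 0).card with hw
  have hw0 : ∀ η, 0 ≤ w η := fun η => pow_nonneg ht.le _
  -- Step 1: pass to the off-seam part (weights only grow since `t ≤ 1`)
  have h1 : closedSum M t ≤ ∑ η ∈ C, w (offSeam η) := by
    unfold closedSum
    refine Finset.sum_le_sum fun η _ => ?_
    exact pow_le_pow_of_le_one ht.le ht1 (card_support_offSeam_le η)
  -- Step 2: fibres of `offSeam` on `C` have at most `2^s` elements
  have h2 : ∑ η ∈ C, w (offSeam η) ≤ ∑ ρ ∈ C.image offSeam, (2 : ℝ) ^ s * w ρ := by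
    rw [Finset.sum_comp]
    refine Finset.sum_le_sum fun ρ _ => ?_
    rw [nsmul_eq_mul]
    refine mul_le_mul_of_nonneg_right ?_ (hw0 ρ)
    have hfib : (C.filter fun η => offSeam η = ρ).card ≤ Fintype.card (seamPlaq 4 M → A2) := by
      rw [← Finset.card_univ]
      refine Finset.card_le_card_of_injOn (fun η (p : seamPlaq 4 M) => η p.1) (fun _ _ => Finset.mem_univ _) ?_
      intro η hη η' hη' hres
      simp only [Finset.coe_filter, Set.mem_setOf_eq] at hη hη'
      funext p
      by_cases hp : p ∈ seamPlaq 4 M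
      · exact congrFun hres ⟨p, hp⟩
      · have e1 := congrFun hη.2 p
        have e2 := congrFun hη'.2 p
        simp only [offSeam, hp, if_false] at e1 e2
        rw [e1, e2]
    calc ((C.filter fun η => offSeam η = ρ).card : ℝ) ≤ Fintype.card (seamPlaq 4 M → A2) := by
          exact_mod_cast hfib
      _ = 2 ^ s := by
          rw [Fintype.card_fun, Fintype.card_coe]; simp [hs]
  -- Step 3: each off-seam part comes from an exact function, at weight cost `t^{-s}`
  have h3 : ∑ ρ ∈ C.image offSeam, (2 : ℝ) ^ s * w ρ ≤ (2 / t) ^ s * exactSum 4 M t := by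
    -- choose an exact representative for every `ρ`
    have hrep : ∀ ρ ∈ C.image offSeam, ∃ b ∈ E, offSeam b = ρ := by
      intro ρ hρ
      obtain ⟨η, hη, rfl⟩ := Finset.mem_image.1 hρ
      exact exists_exact_offSeam_eq (Finset.mem_filter.1 hη).2
    choose! rep hrepE hrepOff using hrep
    have hinj : Set.InjOn rep ↑(C.image offSeam) := by
      intro ρ hρ ρ' hρ' h
      rw [← hrepOff ρ hρ, ← hrepOff ρ' hρ', h]
    calc ∑ ρ ∈ C.image offSeam, (2 : ℝ) ^ s * w ρ
        ≤ ∑ ρ ∈ C.image offSeam, (2 / t) ^ s * w (rep ρ) := by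
          refine Finset.sum_le_sum fun ρ hρ => ?_
          rw [div_pow, div_mul_eq_mul_div, le_div_iff₀ (pow_pos ht s), mul_assoc]
          refine mul_le_mul_of_nonneg_left ?_ (pow_nonneg zero_le_two s)
          rw [hw]
          simp only
          rw [← pow_add]
          refine pow_le_pow_of_le_one ht.le ht1 ?_
          have := card_support_le_offSeam_add (rep ρ)
          rw [hrepOff ρ hρ] at this
          exact this
      _ = (2 / t) ^ s * ∑ ρ ∈ C.image offSeam, w (rep ρ) := by rw [Finset.mul_sum]
      _ = (2 / t) ^ s * ∑ b ∈ (C.image offSeam).image rep, w b := by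
          rw [Finset.sum_image hinj]
      _ ≤ (2 / t) ^ s * exactSum 4 M t := by
          refine mul_le_mul_of_nonneg_left ?_ (pow_nonneg (div_nonneg zero_le_two ht.le) s)
          unfold exactSum
          refine Finset.sum_le_sum_of_subset_of_nonneg (fun b hb => ?_) (fun b _ _ => hw0 b)
          obtain ⟨ρ, hρ, rfl⟩ := Finset.mem_image.1 hb
          exact hrepE ρ hρ
  exact h1.trans (h2.trans h3)

end Summit.QuantumFields.YangMills.Theorems.Z2SelfDuality
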